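import Mathlib
import Summits.Ventures.HodgeRepro2.T5SchurOrthogonality
import Summits.Ventures.HodgeRepro2.T5CompleteReducibility

/-!
# T5RestrictionRep — the restriction of a representation to a stable subspace; characters add
over a direct-sum decomposition

Tier-5 support (seat p1, cell pub-hodge-repro2), companion of `T5CompleteReducibility.lean`
(p395089): the summands of the orthogonal decomposition there become representations in their own
right, and the character of `π` is the sum of their characters.

* `restrictCLM` / `restrictRep π W hW : G →* (W →L[ℂ] W)`: the restriction of `π` to a `π`-stable
  subspace `W`, acting as `π g` on the underlying vectors (`coe_restrictRep_apply`);
* `isUnitary_restrictRep`: the restriction of a unitary representation is unitary;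
* `isStable_restrictRep_iff`: subspaces of `W` stable for the restriction ↔ `π`-stable subspaces
  of `V` inside `W`; `isIrreducible_restrictRep`: the restriction to an irreducible stable subspace
  is an irreducible representation (`IsIrreducible` of `T5SchurOrthogonality`);
* `character_eq_sum_restrict` / `character_eq_sum_restrict_finset`: **character additivity**
  `χ_π = Σ_i χ_{π|N i}` over an internal direct sum of stable subspaces (Mathlib's
  `LinearMap.trace_eq_sum_trace_restrict`) — in particular over the decomposition produced by
  `T5CompleteReducibility.exists_isInternal_irreducible`.

Goodman–Wallach GTM 255 uses these as the standard bookkeeping of §4.3 («the character of a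
representation is the sum of the characters of its irreducible constituents»); the printed locator
of the multiplicity formula itself is recorded in the next file. Honest scope: nothing about any
specific group or about (N).
-/

noncomputable section
namespace Summit.Ventures.HodgeRepro2.T5RestrictionRep

open Summit.Ventures.HodgeRepro2.T5SchurOrthogonality
open Summit.Ventures.HodgeRepro2.T5CompleteReducibility
open scoped InnerProductSpace

variable {G : Type*} [Group G]
variable {V : Type*} [NormedAddCommGroup V] [InnerProductSpace ℂ V]
variable (π : G →* (V →L[ℂ] V))

/-- The restriction of `π g` to a `π`-stable subspace `W`, as a continuous linear map on `W`. -/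
def restrictCLM (W : Submodule ℂ V) (hW : IsStable π W) (g : G) : W →L[ℂ] W :=
  ((π g).comp W.subtypeL).codRestrict W (fun x => hW g x x.2)

/-- `restrictCLM` acts as `π g` on the underlying vectors. -/
@[simp] theorem coe_restrictCLM_apply (W : Submodule ℂ V) (hW : IsStable π W) (g : G) (x : W) :
    (restrictCLM π W hW g x : V) = π g x := rfl

/-- The restricted representation `G →* (W →L[ℂ] W)`. -/
def restrictRep (W : Submodule ℂ V) (hW : IsStable π W) : G →* (W →L[ℂ] W) where
  toFun := restrictCLM π W hW
  map_one' := by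
    ext x
    simp [restrictCLM]
  map_mul' g h := by
    ext x
    simp [restrictCLM, mul_apply_eq_comp]

/-- `restrictRep` acts as `π g` on the underlying vectors. -/
@[simp] theorem coe_restrictRep_apply (W : Submodule ℂ V) (hW : IsStable π W) (g : G) (x : W) :
    (restrictRep π W hW g x : V) = π g x := rfl

/-- The restriction of a unitary representation is unitary. -/
theorem isUnitary_restrictRep (hu : IsUnitary π) (W : Submodule ℂ V) (hW : IsStable π W) :
    IsUnitary (restrictRep π W hW) := by
  intro g a b
  rw [Submodule.coe_inner, Submodule.coe_inner, coe_restrictRep_apply, coe_restrictRep_apply]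
  exact hu g a b

/-- A subspace of `W` is stable for the restriction iff its image in `V` is `π`-stable. -/
theorem isStable_restrictRep_iff (W : Submodule ℂ V) (hW : IsStable π W) (U : Submodule ℂ W) :
    IsStable (restrictRep π W hW) U ↔ IsStable π (U.map W.subtype) := by
  constructor
  · intro hU g x hx
    rw [Submodule.mem_map] at hx ⊢
    obtain ⟨y, hy, rfl⟩ := hx
    exact ⟨restrictRep π W hW g y, hU g y hy, rfl⟩
  · intro hU g x hx
    have h1 : π g x ∈ U.map W.subtype := hU g x (Submodule.mem_map_of_mem hx)
    rw [Submodule.mem_map] at h1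
    obtain ⟨y, hy, hyx⟩ := h1
    have : restrictRep π W hW g x = y := Subtype.ext (by simpa using hyx.symm)
    rw [this]
    exact hy

/-- The restriction of `π` to an irreducible stable subspace is an irreducible representation. -/
theorem isIrreducible_restrictRep (W : Submodule ℂ V) (hW : IsIrreducibleSubspace π W)
    (hst : IsStable π W) : IsIrreducible (restrictRep π W hst) := by
  obtain ⟨-, -, hmin⟩ := hW
  intro U hU
  have hU' : IsStable π (U.map W.subtype) := (isStable_restrictRep_iff π W hst U).mp hU
  rcases hmin (U.map W.subtype) (Submodule.map_subtype_le W U) hU' with h | h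
  · left
    rw [Submodule.eq_bot_iff]
    intro x hx
    have hx' : (x : V) ∈ Submodule.map W.subtype U := Submodule.mem_map_of_mem hx
    rw [h, Submodule.mem_bot] at hx'
    exact Subtype.ext hx'
  · right
    calc U = Submodule.comap W.subtype (Submodule.map W.subtype U) :=
          (Submodule.comap_map_eq_of_injective Subtype.coe_injective U).symm
      _ = Submodule.comap W.subtype W := by rw [h]
      _ = ⊤ := Submodule.comap_subtype_self W

/-- `W` is non-trivial as a type when it is an irreducible stable subspace. -/
theorem nontrivial_of_isIrreducibleSubspace (W : Submodule ℂ V) (hW : IsIrreducibleSubspace π W) :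
    Nontrivial W :=
  Submodule.nontrivial_iff_ne_bot.mpr hW.1

/-- **Character additivity** over an internal direct sum of stable subspaces:
`χ_π = Σ_i χ_{π|N i}`. -/
theorem character_eq_sum_restrict {ι : Type*} [Fintype ι] [DecidableEq ι] [FiniteDimensional ℂ V]
    (N : ι → Submodule ℂ V) (hN : DirectSum.IsInternal N) (hst : ∀ i, IsStable π (N i)) (g : G) :
    character π g = ∑ i, character (restrictRep π (N i) (hst i)) g := by
  unfold character
  rw [LinearMap.trace_eq_sum_trace_restrict hN (f := ((π g : V →L[ℂ] V) : V →ₗ[ℂ] V))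
    (fun i => fun x hx => hst i g x hx)]
  refine Finset.sum_congr rfl fun i _ => ?_
  rfl

/-- Character additivity for a finite set `S` of stable subspaces forming an internal direct sum
(the shape produced by `T5CompleteReducibility.exists_isInternal_irreducible`). -/
theorem character_eq_sum_restrict_finset [FiniteDimensional ℂ V] (S : Finset (Submodule ℂ V))
    (hN : DirectSum.IsInternal (fun W : S => (W : Submodule ℂ V)))
    (hst : ∀ W ∈ S, IsStable π W) (g : G) :
    character π g = ∑ W : S, character (restrictRep π W (hst W W.2)) g := by
  classical
  exact character_eq_sum_restrict π (fun W : S => (W : Submodule ℂ V)) hN (fun W => hst W W.2) g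

end Summit.Ventures.HodgeRepro2.T5RestrictionRep
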